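import Summits.AtomisticToContinuum.FouriersLaw.Theorems.JunctionLocalityNonBallisticLightConeAssemblyPart2b
import Summits.AtomisticToContinuum.FouriersLaw.Theorems.PhononMeanFreePathIncoherentChannelCommonPastBoundHelper1
import Literature.MathematicalPhysics.KineticTheory.LangevinChainExpMartingale

/-!
# Large time-integrated momenta are improbable under the stationary law (Gibbs ⊗ Wiener)

Helper (`--supports`) for the line `contact-current-forgetting` of the crux `JunctionLocality.NonBallistic`
(stmt-AtomisticToContinuum-9127), stub `stub_lightConeWindow` (LC), missing fact (FS), piece (C) of the
assembly FS-A + FS-BC + FS-D. Let `Φ_r(x, B ω) = (pinnedChain ω₂ lam β γ).solMap N T T r x (pairPath ω)` be the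
strong solution of the Langevin chain with both baths at temperature `T`, started at `x` and driven by the
Brownian pair `B ω`, and let `μ_T = gibbsMeasure N T`, `W = wienerPair`. For the time-integrated squared
momenta `X_i(x, ω) = ∫₀ᵗ p_i(Φ_r(x, Bω))² dr` we prove

  `(μ_T ⊗ W) {∃ i, a < X_i} ≤ ENNReal.ofReal (105 T⁴ · N · t⁴ / a⁴)`     (`t ≥ 0`, `a > 0`),

the complement of the event on which the kinematic bound of piece (B)
(`pinnedChain_solMap_position_sq_le`, `…LightConeKinematics`) controls all positions on `[0, t]`.

Mechanism: union bound over the `N` sites; for each site Markov with the fourth power,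
`P(X_i > a) ≤ E X_i⁴ / a⁴`; Cauchy–Schwarz in time twice, `X_i⁴ ≤ t²(∫₀ᵗ p_i⁴)² ≤ t³ ∫₀ᵗ p_i⁸`; Tonelli;
STATIONARITY of the kernel process started from the Gibbs measure on the Wiener space
(`FSAssembly.lintegral_lintegral_solMap_gibbs`: the law of `Φ_r` under `μ_T ⊗ W` is `μ_T` for every `r`, by
Gibbs invariance of the constructed kernels — no uniqueness needed); and the Gaussian momentum moment
`∫ p_i⁸ dμ_T = 105 T⁴` (`commonPastBound_gibbsEvenMoments`), independent of `N` and `i`. Everything is done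
with Lebesgue integrals in `ℝ≥0∞` (no integrability side conditions) and converted at the end.

* `pinnedChain_lintegral_prod_solMap_gibbs` — stationarity in product form, at every REAL time `r`;
* `pinnedChain_lintegral_timeIntegral_momentum_pow_eight` — `∫∫₀ᵗ p_i(Φ_r)⁸ dr d(μ_T ⊗ W) = 105 T⁴ · t`;
* `pinnedChain_probSite_timeIntegral_momentum_sq_gt` — the one-site tail bound `105 T⁴ t⁴ / a⁴`;
* `pinnedChain_prob_timeIntegral_momentum_sq_gt_le` (registered) — the display above;
* `pinnedChain_measurable_timeIntegral_momentum_pow` — `(x, ω) ↦ ∫₀ᵗ p_i(Φ_r(x, Bω))^k dr` is measurable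
  (so the events above are measurable).
-/

noncomputable section

namespace Summit.AtomisticToContinuum.FouriersLaw.Theorems.NonBallistic

open MeasureTheory ProbabilityTheory Set Filter Topology
open scoped NNReal ENNReal
open Literature.MathematicalPhysics.KineticTheory Literature.MathematicalPhysics.KineticTheory.HeatConduction
open Literature.Probability.Process OscillatorChain
open Summit.AtomisticToContinuum.FouriersLaw.Theorems.PhononMeanFreePath (commonPastBound_gibbsEvenMoments)

/-- **Cauchy–Schwarz in time for powers**: `(∫₀ᵗ f^k)² ≤ t ∫₀ᵗ f^{2k}` for a continuous `f` and `t ≥ 0`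
(the quadratic `s ↦ ∫₀ᵗ (f^k - s)² = t s² - 2 (∫₀ᵗ f^k) s + ∫₀ᵗ f^{2k}` is nonnegative, so its discriminant is
`≤ 0`). [folklore] -/
theorem sq_intervalIntegral_pow_le_mul_intervalIntegral_pow {f : ℝ → ℝ} (hf : Continuous f) {t : ℝ}
    (ht : 0 ≤ t) (k : ℕ) :
    (∫ r in (0:ℝ)..t, f r ^ k) ^ 2 ≤ t * ∫ r in (0:ℝ)..t, f r ^ (2 * k) := by
  -- adapted from `sq_intervalIntegral_le_mul_intervalIntegral_sq` (…NonBallisticLightConeKinematics)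
  set I := ∫ r in (0:ℝ)..t, f r ^ k with hI
  set J := ∫ r in (0:ℝ)..t, f r ^ (2 * k) with hJ
  have hfi : IntervalIntegrable (fun r => f r ^ k) volume 0 t := (hf.pow k).intervalIntegrable 0 t
  have hf2i : IntervalIntegrable (fun r => f r ^ (2 * k)) volume 0 t := (hf.pow (2 * k)).intervalIntegrable 0 t
  have hq : ∀ s : ℝ, 0 ≤ t * (s * s) + (-2 * I) * s + J := by
    intro s
    have h0 : 0 ≤ ∫ r in (0:ℝ)..t, (f r ^ k - s) ^ 2 :=
      intervalIntegral.integral_nonneg ht fun r _ => sq_nonneg _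
    have he : ∫ r in (0:ℝ)..t, (f r ^ k - s) ^ 2 = J - 2 * s * I + (t - 0) * s ^ 2 := by
      have e1 : (fun r => (f r ^ k - s) ^ 2) = fun r => (f r ^ (2 * k) - (2 * s) * f r ^ k) + s ^ 2 := by
        funext r; rw [pow_mul']; ring
      rw [e1, intervalIntegral.integral_add (hf2i.sub (hfi.const_mul _)) intervalIntegrable_const,
        intervalIntegral.integral_sub hf2i (hfi.const_mul _), intervalIntegral.integral_const_mul,
        intervalIntegral.integral_const, smul_eq_mul]
    rw [he] at h0
    nlinarith [h0]
  have hd := discrim_le_zero hq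
  rw [discrim] at hd
  nlinarith [hd]

section MomentumTail

variable {ω₂ lam β γ : ℝ} (hω : 0 < ω₂) (hl : 0 ≤ lam) (hβ : 0 ≤ β) (hγ : 0 ≤ γ) (N : ℕ) {T : ℝ}

/-- The solution map at time `r` is the solution map at time `r⁺ = max(r, 0)` (it is the initial condition for
`r ≤ 0`, `pinnedChain_solMap_of_nonpos`). [folklore] -/
theorem pinnedChain_solMap_eq_solMap_toNNReal (T_L T_R r : ℝ) (x : PhaseSpace N) (w : WienerPair) :
    (pinnedChain ω₂ lam β γ).solMap N T_L T_R r x w =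
      (pinnedChain ω₂ lam β γ).solMap N T_L T_R ((r.toNNReal : ℝ≥0) : ℝ) x w := by
  rcases le_or_gt 0 r with hr | hr
  · rw [Real.coe_toNNReal r hr]
  · rw [Real.toNNReal_of_nonpos hr.le, NNReal.coe_zero,
      pinnedChain_solMap_of_nonpos N T_L T_R x w hr.le, pinnedChain_solMap_of_nonpos N T_L T_R x w le_rfl]

include hω hl hβ hγ in
/-- Joint measurability of `((x, ω), r) ↦ Φ_r(x, B ω)` (arguments swapped, for Tonelli in time). [folklore] -/
theorem pinnedChain_measurable_solMap_pairPath_uncurry_swap (T_L T_R : ℝ) :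
    Measurable fun p : (PhaseSpace N × WienerPair) × ℝ =>
      (pinnedChain ω₂ lam β γ).solMap N T_L T_R p.2 p.1.1 (pairPath p.1.2) := by
  have hg : Measurable fun p : (PhaseSpace N × WienerPair) × ℝ => (p.2, (p.1.1, pairPath p.1.2)) :=
    measurable_snd.prodMk ((measurable_fst.comp measurable_fst).prodMk
      (measurable_pairPath.comp (measurable_snd.comp measurable_fst)))
  have h := (pinnedChain_measurable_uncurry_solMap hω hl hβ hγ N T_L T_R).comp hg
  exact h

include hω hl hβ hγ in
/-- The time-integrated power of a momentum along the flow, `(x, ω) ↦ ∫₀ᵗ p_i(Φ_r(x, Bω))^k dr`, is jointly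
measurable in the start and the Brownian sample. [folklore] -/
theorem pinnedChain_measurable_timeIntegral_momentum_pow (T_L T_R t : ℝ) (i : Fin N) (k : ℕ) :
    Measurable fun q : PhaseSpace N × WienerPair =>
      ∫ r in (0:ℝ)..t, ((pinnedChain ω₂ lam β γ).solMap N T_L T_R r q.1 (pairPath q.2)).2 i ^ k := by
  refine measurable_intervalIntegral_of_continuous_of_measurable (fun q => ?_) (fun r => ?_) t
  · exact ((continuous_apply i).comp (continuous_snd.comp
      (pinnedChain_continuous_solMap hω hl hβ hγ N T_L T_R q.1 (pairPath q.2)))).pow k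
  · exact ((measurable_pi_apply i).comp (measurable_snd.comp
      (pinnedChain_measurable_solMap_pairPath hω hl hβ hγ N T_L T_R r))).pow_const k

include hω hl hβ hγ in
/-- **Stationarity of the kernel process from the Gibbs measure, product form, at every real time `r`**:
`∫⁻ g(Φ_r(x, Bω)) d(μ_T ⊗ W)(x, ω) = ∫⁻ g dμ_T` for measurable `g ≥ 0` (Tonelli +
`FSAssembly.lintegral_lintegral_solMap_gibbs` at `r⁺`). [folklore] -/
theorem pinnedChain_lintegral_prod_solMap_gibbs (hN : 0 < N) (hT : 0 < T) (r : ℝ) {g : PhaseSpace N → ℝ≥0∞}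
    (hg : Measurable g) :
    ∫⁻ q, g ((pinnedChain ω₂ lam β γ).solMap N T T r q.1 (pairPath q.2))
        ∂(((pinnedChain ω₂ lam β γ).gibbsMeasure N T).prod wienerPair) =
      ∫⁻ y, g y ∂((pinnedChain ω₂ lam β γ).gibbsMeasure N T) := by
  have hF := pinnedChain_measurable_solMap_pairPath hω hl hβ hγ N T T r
  rw [lintegral_prod (fun q : PhaseSpace N × WienerPair =>
    g ((pinnedChain ω₂ lam β γ).solMap N T T r q.1 (pairPath q.2))) (hg.comp hF).aemeasurable]
  have h := FSAssembly.lintegral_lintegral_solMap_gibbs hω hl hβ hγ hN hT hg r.toNNReal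
  refine Eq.trans (lintegral_congr fun x => lintegral_congr fun ω => ?_) h
  dsimp only
  rw [pinnedChain_solMap_eq_solMap_toNNReal N T T r]

include hω hl hβ hγ in
/-- **Tonelli + stationarity + the Gaussian eighth moment**:
`∫ (∫_{(0,t]} p_i(Φ_r(x,Bω))⁸ dr) d(μ_T ⊗ W) = 105 T⁴ · t⁺` (Lebesgue form; both sides vanish for `t ≤ 0`).
[folklore] -/
theorem pinnedChain_lintegral_timeIntegral_momentum_pow_eight (hN : 0 < N) (hT : 0 < T) (t : ℝ) (i : Fin N) :
    ∫⁻ q, (∫⁻ r in Ioc 0 t, ENNReal.ofReal (((pinnedChain ω₂ lam β γ).solMap N T T r q.1 (pairPath q.2)).2 i ^ 8))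
        ∂(((pinnedChain ω₂ lam β γ).gibbsMeasure N T).prod wienerPair) =
      ENNReal.ofReal (105 * T ^ 4) * ENNReal.ofReal t := by
  haveI : IsProbabilityMeasure ((pinnedChain ω₂ lam β γ).gibbsMeasure N T) :=
    pinnedChain_isProbabilityMeasure_gibbsMeasure hω hl hβ γ N hT
  have hf : Measurable fun qr : (PhaseSpace N × WienerPair) × ℝ =>
      ENNReal.ofReal (((pinnedChain ω₂ lam β γ).solMap N T T qr.2 qr.1.1 (pairPath qr.1.2)).2 i ^ 8) := by
    have h1 := pinnedChain_measurable_solMap_pairPath_uncurry_swap hω hl hβ hγ N T T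
    exact (((measurable_pi_apply i).comp (measurable_snd.comp h1)).pow_const 8).ennreal_ofReal
  have hswap : ∫⁻ q, (∫⁻ r in Ioc 0 t,
        ENNReal.ofReal (((pinnedChain ω₂ lam β γ).solMap N T T r q.1 (pairPath q.2)).2 i ^ 8))
        ∂(((pinnedChain ω₂ lam β γ).gibbsMeasure N T).prod wienerPair) =
      ∫⁻ r in Ioc 0 t, (∫⁻ q,
        ENNReal.ofReal (((pinnedChain ω₂ lam β γ).solMap N T T r q.1 (pairPath q.2)).2 i ^ 8)
        ∂(((pinnedChain ω₂ lam β γ).gibbsMeasure N T).prod wienerPair)) := by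
    have hf' : AEMeasurable (Function.uncurry fun (q : PhaseSpace N × WienerPair) (r : ℝ) =>
        ENNReal.ofReal (((pinnedChain ω₂ lam β γ).solMap N T T r q.1 (pairPath q.2)).2 i ^ 8))
        ((((pinnedChain ω₂ lam β γ).gibbsMeasure N T).prod wienerPair).prod (volume.restrict (Ioc 0 t))) :=
      hf.aemeasurable
    exact lintegral_lintegral_swap hf'
  rw [hswap]
  have hstat : ∀ r : ℝ, (∫⁻ q,
      ENNReal.ofReal (((pinnedChain ω₂ lam β γ).solMap N T T r q.1 (pairPath q.2)).2 i ^ 8)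
        ∂(((pinnedChain ω₂ lam β γ).gibbsMeasure N T).prod wienerPair)) = ENNReal.ofReal (105 * T ^ 4) := by
    intro r
    rw [pinnedChain_lintegral_prod_solMap_gibbs hω hl hβ hγ N hN hT r
      (g := fun y : PhaseSpace N => ENNReal.ofReal (y.2 i ^ 8)) (by fun_prop)]
    obtain ⟨hint, hval⟩ := commonPastBound_gibbsEvenMoments ω₂ lam β γ hω hl hβ T hT N i 4
    norm_num at hint hval
    rw [← ofReal_integral_eq_lintegral_ofReal hint (ae_of_all _ fun y => by positivity), hval]
    congr 1
    ring
  rw [lintegral_congr hstat, setLIntegral_const, Real.volume_Ioc, sub_zero]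

include hω hl hβ hγ in
/-- **One-site tail bound.** For `t ≥ 0`, `a > 0` and every site `i`,
`(μ_T ⊗ W) {a < ∫₀ᵗ p_i(Φ_r(x,Bω))² dr} ≤ ENNReal.ofReal (105 T⁴ t⁴ / a⁴)` (Markov with the fourth power,
Cauchy–Schwarz in time twice, Tonelli, stationarity, `∫ p_i⁸ dμ_T = 105 T⁴`). [folklore] -/
theorem pinnedChain_probSite_timeIntegral_momentum_sq_gt (hN : 0 < N) (hT : 0 < T) {t a : ℝ} (ht : 0 ≤ t)
    (ha : 0 < a) (i : Fin N) :
    (((pinnedChain ω₂ lam β γ).gibbsMeasure N T).prod wienerPair)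
        {q | a < ∫ r in (0:ℝ)..t, ((pinnedChain ω₂ lam β γ).solMap N T T r q.1 (pairPath q.2)).2 i ^ 2} ≤
      ENNReal.ofReal (105 * T ^ 4 * t ^ 4 / a ^ 4) := by
  haveI : IsProbabilityMeasure ((pinnedChain ω₂ lam β γ).gibbsMeasure N T) :=
    pinnedChain_isProbabilityMeasure_gibbsMeasure hω hl hβ γ N hT
  set π := ((pinnedChain ω₂ lam β γ).gibbsMeasure N T).prod wienerPair with hπ
  -- the momenta along the flow
  set p : ℝ → PhaseSpace N × WienerPair → ℝ := fun r q =>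
    ((pinnedChain ω₂ lam β γ).solMap N T T r q.1 (pairPath q.2)).2 i with hp
  have hpc : ∀ q, Continuous fun r => p r q := fun q =>
    (continuous_apply i).comp (continuous_snd.comp
      (pinnedChain_continuous_solMap hω hl hβ hγ N T T q.1 (pairPath q.2)))
  have hpm : ∀ k : ℕ, Measurable fun qr : (PhaseSpace N × WienerPair) × ℝ => ENNReal.ofReal (p qr.2 qr.1 ^ k) := by
    intro k
    have h1 := pinnedChain_measurable_solMap_pairPath_uncurry_swap hω hl hβ hγ N T T
    exact (((measurable_pi_apply i).comp (measurable_snd.comp h1)).pow_const k).ennreal_ofReal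
  -- Lebesgue versions of `X = ∫₀ᵗ p²` and `Y = ∫₀ᵗ p⁸`
  set Xl : PhaseSpace N × WienerPair → ℝ≥0∞ := fun q => ∫⁻ r in Ioc 0 t, ENNReal.ofReal (p r q ^ 2) with hXl
  set Yl : PhaseSpace N × WienerPair → ℝ≥0∞ := fun q => ∫⁻ r in Ioc 0 t, ENNReal.ofReal (p r q ^ 8) with hYl
  have hXlm : Measurable Xl := (hpm 2).lintegral_prod_right'
  have hofReal : ∀ {k : ℕ}, Even k → ∀ q : PhaseSpace N × WienerPair,
      ENNReal.ofReal (∫ r in (0:ℝ)..t, p r q ^ k) = ∫⁻ r in Ioc 0 t, ENNReal.ofReal (p r q ^ k) := by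
    intro k hk q
    rw [intervalIntegral.integral_of_le ht]
    exact ofReal_integral_eq_lintegral_ofReal ((hpc q).pow k).integrableOn_Ioc
      (ae_of_all _ fun r => hk.pow_nonneg _)
  -- pointwise: `X⁴ ≤ t³ Y` (Cauchy–Schwarz in time, twice)
  have hJ : ∀ q, Xl q ^ 4 ≤ ENNReal.ofReal (t ^ 3) * Yl q := by
    intro q
    have hX0 : 0 ≤ ∫ r in (0:ℝ)..t, p r q ^ 2 := intervalIntegral.integral_nonneg ht fun r _ => sq_nonneg _
    have h1 := sq_intervalIntegral_pow_le_mul_intervalIntegral_pow (hpc q) ht 2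
    have h2 := sq_intervalIntegral_pow_le_mul_intervalIntegral_pow (hpc q) ht 4
    norm_num at h1 h2
    have hreal : (∫ r in (0:ℝ)..t, p r q ^ 2) ^ 4 ≤ t ^ 3 * ∫ r in (0:ℝ)..t, p r q ^ 8 :=
      calc (∫ r in (0:ℝ)..t, p r q ^ 2) ^ 4 = ((∫ r in (0:ℝ)..t, p r q ^ 2) ^ 2) ^ 2 := by ring
        _ ≤ (t * ∫ r in (0:ℝ)..t, p r q ^ 4) ^ 2 := pow_le_pow_left₀ (sq_nonneg _) h1 2
        _ = t ^ 2 * (∫ r in (0:ℝ)..t, p r q ^ 4) ^ 2 := by ring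
        _ ≤ t ^ 2 * (t * ∫ r in (0:ℝ)..t, p r q ^ 8) := mul_le_mul_of_nonneg_left h2 (sq_nonneg _)
        _ = t ^ 3 * ∫ r in (0:ℝ)..t, p r q ^ 8 := by ring
    calc Xl q ^ 4 = ENNReal.ofReal ((∫ r in (0:ℝ)..t, p r q ^ 2) ^ 4) := by
          rw [ENNReal.ofReal_pow hX0, hofReal even_two q]
      _ ≤ ENNReal.ofReal (t ^ 3 * ∫ r in (0:ℝ)..t, p r q ^ 8) := ENNReal.ofReal_le_ofReal hreal
      _ = ENNReal.ofReal (t ^ 3) * Yl q := by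
          rw [ENNReal.ofReal_mul (pow_nonneg ht 3), hofReal (by decide) q]
  -- the event, Markov with the fourth power, and the moment computation
  have hsub : {q : PhaseSpace N × WienerPair | a < ∫ r in (0:ℝ)..t, p r q ^ 2} ⊆
      {q | ENNReal.ofReal a ^ 4 ≤ Xl q ^ 4} := by
    intro q hq
    simp only [Set.mem_setOf_eq] at hq ⊢
    have h : ENNReal.ofReal a ≤ Xl q := by
      show ENNReal.ofReal a ≤ ∫⁻ r in Ioc 0 t, ENNReal.ofReal (p r q ^ 2)
      rw [← hofReal even_two q]
      exact ENNReal.ofReal_le_ofReal hq.le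
    gcongr
  have ha4 : ENNReal.ofReal a ^ 4 ≠ 0 := pow_ne_zero _ (ENNReal.ofReal_pos.2 ha).ne'
  have ha4' : ENNReal.ofReal a ^ 4 ≠ ∞ := ENNReal.pow_ne_top ENNReal.ofReal_ne_top
  have hYI : ∫⁻ q, Yl q ∂π = ENNReal.ofReal (105 * T ^ 4) * ENNReal.ofReal t :=
    pinnedChain_lintegral_timeIntegral_momentum_pow_eight hω hl hβ hγ N hN hT t i
  calc π {q | a < ∫ r in (0:ℝ)..t, p r q ^ 2}
      ≤ π {q | ENNReal.ofReal a ^ 4 ≤ Xl q ^ 4} := measure_mono hsub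
    _ ≤ (∫⁻ q, Xl q ^ 4 ∂π) / ENNReal.ofReal a ^ 4 :=
        meas_ge_le_lintegral_div (hXlm.pow_const 4).aemeasurable ha4 ha4'
    _ ≤ (∫⁻ q, ENNReal.ofReal (t ^ 3) * Yl q ∂π) / ENNReal.ofReal a ^ 4 :=
        ENNReal.div_le_div_right (lintegral_mono fun q => hJ q) _
    _ = ENNReal.ofReal (t ^ 3) * (ENNReal.ofReal (105 * T ^ 4) * ENNReal.ofReal t) / ENNReal.ofReal a ^ 4 := by
        rw [lintegral_const_mul' _ _ ENNReal.ofReal_ne_top, hYI]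
    _ = ENNReal.ofReal (105 * T ^ 4 * t ^ 4 / a ^ 4) := by
        rw [show 105 * T ^ 4 * t ^ 4 / a ^ 4 = t ^ 3 * (105 * T ^ 4 * t) / a ^ 4 by ring,
          ENNReal.ofReal_div_of_pos (pow_pos ha 4), ENNReal.ofReal_mul (pow_nonneg ht 3),
          ENNReal.ofReal_mul (by positivity : (0:ℝ) ≤ 105 * T ^ 4), ENNReal.ofReal_pow ha.le]

end MomentumTail

/-- **Registered helper `pinnedChain_prob_timeIntegral_momentum_sq_gt_le`** (piece (C) of (FS), line
`contact-current-forgetting`): under the stationary law `μ_T ⊗ W` of the pinned anharmonic chain with both baths at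
temperature `T > 0` (Gibbs start, independent Brownian pair), the probability that some time-integrated squared
momentum `∫₀ᵗ p_i(Φ_r(x, Bω))² dr` exceeds `a > 0` is at most `C N t⁴ / a⁴` with `C = C(T) = 105 T⁴`
(union bound + fourth-power Markov + Cauchy–Schwarz in time + Tonelli + stationarity + Gaussian eighth momentum
moments). [folklore] -/
theorem pinnedChain_prob_timeIntegral_momentum_sq_gt_le :
    ∀ ω₂ lam β γ : ℝ, 0 < ω₂ → 0 ≤ lam → 0 ≤ β → 0 ≤ γ → ∀ T : ℝ, 0 < T →
      ∃ C : ℝ, 0 ≤ C ∧ ∀ (N : ℕ) (t a : ℝ), 0 ≤ t → 0 < a →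
        (((pinnedChain ω₂ lam β γ).gibbsMeasure N T).prod wienerPair)
            {q : PhaseSpace N × WienerPair | ∃ i : Fin N,
              a < ∫ r in (0:ℝ)..t, ((pinnedChain ω₂ lam β γ).solMap N T T r q.1 (pairPath q.2)).2 i ^ 2} ≤
          ENNReal.ofReal (C * N * t ^ 4 / a ^ 4) := by
  intro ω₂ lam β γ hω hl hβ hγ T hT
  refine ⟨105 * T ^ 4, by positivity, fun N t a ht ha => ?_⟩
  rcases Nat.eq_zero_or_pos N with hN0 | hN
  · subst hN0
    have he : {q : PhaseSpace 0 × WienerPair | ∃ i : Fin 0,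
        a < ∫ r in (0:ℝ)..t, ((pinnedChain ω₂ lam β γ).solMap 0 T T r q.1 (pairPath q.2)).2 i ^ 2} = ∅ := by
      ext q
      simp only [Set.mem_setOf_eq, Set.mem_empty_iff_false, iff_false, not_exists]
      exact fun i => i.elim0
    rw [he, measure_empty]
    exact bot_le
  have hU : {q : PhaseSpace N × WienerPair | ∃ i : Fin N,
      a < ∫ r in (0:ℝ)..t, ((pinnedChain ω₂ lam β γ).solMap N T T r q.1 (pairPath q.2)).2 i ^ 2} =
      ⋃ i : Fin N, {q | a < ∫ r in (0:ℝ)..t, ((pinnedChain ω₂ lam β γ).solMap N T T r q.1 (pairPath q.2)).2 i ^ 2} := by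
    ext q
    simp
  rw [hU]
  calc (((pinnedChain ω₂ lam β γ).gibbsMeasure N T).prod wienerPair) (⋃ i : Fin N,
        {q | a < ∫ r in (0:ℝ)..t, ((pinnedChain ω₂ lam β γ).solMap N T T r q.1 (pairPath q.2)).2 i ^ 2})
      ≤ ∑ i : Fin N, (((pinnedChain ω₂ lam β γ).gibbsMeasure N T).prod wienerPair)
          {q | a < ∫ r in (0:ℝ)..t, ((pinnedChain ω₂ lam β γ).solMap N T T r q.1 (pairPath q.2)).2 i ^ 2} :=
        measure_iUnion_fintype_le _ _
    _ ≤ ∑ _i : Fin N, ENNReal.ofReal (105 * T ^ 4 * t ^ 4 / a ^ 4) :=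
        Finset.sum_le_sum fun i _ =>
          pinnedChain_probSite_timeIntegral_momentum_sq_gt hω hl hβ hγ N hN hT ht ha i
    _ = ENNReal.ofReal (105 * T ^ 4 * N * t ^ 4 / a ^ 4) := by
        rw [Finset.sum_const, Finset.card_univ, Fintype.card_fin, nsmul_eq_mul, ← ENNReal.ofReal_natCast,
          ← ENNReal.ofReal_mul (Nat.cast_nonneg N)]
        congr 1
        ring

end Summit.AtomisticToContinuum.FouriersLaw.Theorems.NonBallistic

end
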